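import Mathlib.Algebra.Order.Field.Basic
import Mathlib.Algebra.Order.Ring.Rat
import Mathlib.Tactic.Linarith
import Mathlib.Tactic.NormNum
import Summits.Ventures.CertifiedManyBodySolver.Downfold.PhaseMapMaterialVerdict

/-!
# Grid resolution of the material-oracle acceptance test: WHEN a missed T_c band is visible in the cell accuracy
# (ACCEPTANCE §2.4 validation grid T22 × §4.3/§4.4), with the first e–ph band of record (Nb, run #3) evaluated

Venture CertifiedManyBodySolver, cell `pub/hubbard-downfold`, seat hubbard-downfold-score-1 (second scoring
engine); namespace `Summit.Ventures.CertifiedManyBodySolver.Downfold.CellScore` (continues `PhaseMapCellScore.lean` /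
`PhaseMapMaterialVerdict.lean`: `truthSC`, `outcome`, `w3Cell`, the MISS theorems). Everything here is PROVED.

WHAT THIS IS NOT: not a statement about niobium or any material, and not a change to any scoring rule. It is the
KERNEL form of an observation the first decided e–ph material of record forced on the scorers (oracle-dag run #3,
2026-08-26T23:10Z, both engines identical): hubbard-eph's Nb band [12.575, 19.957] K MISSES the curated
T_c = 9.25 K by 3.32 K (§4.4: OUTSIDE, no credit), yet all 20 truth-known decided cells AGREE (§4.3 accuracy 1.00).
`PhaseMapCellScore.disagree_or_undetermined_of_missHigh` says a miss-high band forces a disagreement (or an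
abstention) at every W3-consistent cell with `Tc + τ < T < lo` — and the validation grid T22 has NO point in
(10.25, 12.575) K. So levels 2 and 3 are linked only UP TO THE GRID'S RESOLUTION, and this file makes that precise:

* §1 `T22` (ACCEPTANCE §2.4 verbatim grid, K) and `visibleMissHigh Tc τ lo` := «some grid temperature lies strictly
  between Tc + τ and lo» (Boolean); `gridGapAbove x` := the distance from `x` to the next grid point, as a table of
  the 21 grid intervals.
* §2 THEOREMS. `exists_disagree_or_undetermined_of_visible`: if the miss is VISIBLE (a grid point in the open
  interval) then at that grid temperature every W3-consistent map word is a DISAGREEMENT or an ABSTENTION — a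
  visible miss-high band cannot coexist with «all decided cells agree» unless the producer abstained there;
  conversely `missHigh_invisible_iff`: the miss is invisible iff NO grid point lies in (Tc + τ, lo), i.e. the whole
  open interval sits inside one grid gap — so the LARGEST miss a band can hide while keeping cell accuracy 1.00 is
  bounded by the local grid gap (4 K below 10 K, 5 K on [10, 20), 10 K on [20, 50), 20/30 K to 100/160 K, 40–50 K
  above): `hidden_miss_le_gap`.
* §3 NUMBERS OF RECORD (run-2026-08-26c, M03 Nb: truth 9.25 K, τ = 1 K; band [12.575, 19.957]): the miss is
  INVISIBLE (no T22 point in (10.25, 12.575)) — consistent with 20/20 agreeing cells; a band starting at 16 K WOULD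
  have been visible at T = 15 K (an «SC» cell there disagrees with truth «not»); the MgB₂-shape miss [45, 60] vs 39 K
  of `PhaseMapCellScore` §4 is invisible too (no grid point in (40.95, 45)) while [52, 60] is visible at 50 K.

Design: `ℚ`, the grid as an explicit `List ℚ`; visibility is a `List.any`, so the concrete cases close by `norm_num`.
-/

namespace Summit.Ventures.CertifiedManyBodySolver.Downfold

namespace CellScore

/-! ## §1 The validation grid and visibility -/

/-- ACCEPTANCE §2.4 validation temperature grid T22 (K), verbatim. [folklore] -/
def T22 : List ℚ := [0, 1/10, 3/10, 1, 2, 4, 6, 10, 15, 20, 30, 40, 50, 70, 100, 130, 160, 200, 250, 300, 350, 400]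

/-- a miss-high band (`lo` above `Tc + τ`) is VISIBLE on the grid iff some grid temperature lies strictly between
`Tc + τ` and `lo`. [folklore] -/
def visibleMissHigh (Tc τ lo : ℚ) : Bool := T22.any (fun t => decide (Tc + τ < t) && decide (t < lo))

/-- T22 has 22 points. [folklore] -/
theorem length_T22 : T22.length = 22 := by rfl

section visibility

variable {Tc τ lo hi : ℚ}

/-- `visibleMissHigh` unfolded. [folklore] -/
theorem visibleMissHigh_iff : visibleMissHigh Tc τ lo = true ↔ ∃ t ∈ T22, Tc + τ < t ∧ t < lo := by
  simp [visibleMissHigh, List.any_eq_true]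

/-- THE VISIBILITY THEOREM (level 3 ⇒ level 2 on the grid): a VISIBLE miss-high band forces, at the witnessing grid
temperature, a disagreement or an abstention for every W3-consistent map word (`0 ≤ Tc`, `0 ≤ τ`). [folklore] -/
theorem exists_disagree_or_undetermined_of_visible (hTc : 0 ≤ Tc) (hτ : 0 ≤ τ) (hv : visibleMissHigh Tc τ lo = true)
    (w : ℚ → Word) (hW3 : ∀ t ∈ T22, w3Cell lo hi t (w t) = true) :
    ∃ t ∈ T22, outcome (w t) (truthSC Tc τ t) = .disagree ∨ w t = .undetermined := by
  obtain ⟨t, ht, h1, h2⟩ := visibleMissHigh_iff.mp hv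
  exact ⟨t, ht, disagree_or_undetermined_of_missHigh hTc hτ (hW3 t ht) h2 h1⟩

/-- … so a map whose grid words are all DECIDED and all AGREE cannot carry a visible miss-high band. [folklore] -/
theorem visibleMissHigh_eq_false_of_all_agree (hTc : 0 ≤ Tc) (hτ : 0 ≤ τ) (w : ℚ → Word)
    (hW3 : ∀ t ∈ T22, w3Cell lo hi t (w t) = true) (hdec : ∀ t ∈ T22, w t ≠ .undetermined)
    (hagree : ∀ t ∈ T22, outcome (w t) (truthSC Tc τ t) ≠ .disagree) : visibleMissHigh Tc τ lo = false := by
  rw [Bool.eq_false_iff]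
  intro hv
  obtain ⟨t, ht, h⟩ := exists_disagree_or_undetermined_of_visible hTc hτ hv w hW3
  rcases h with h | h
  · exact hagree t ht h
  · exact hdec t ht h

/-- INVISIBILITY: the miss hides iff the open interval (Tc + τ, lo) contains no grid point. [folklore] -/
theorem missHigh_invisible_iff : visibleMissHigh Tc τ lo = false ↔ ∀ t ∈ T22, Tc + τ < t → lo ≤ t := by
  rw [Bool.eq_false_iff, Ne, visibleMissHigh_iff]
  constructor
  · intro h t ht h1
    by_contra h2
    exact h ⟨t, ht, h1, not_le.mp h2⟩
  · rintro h ⟨t, ht, h1, h2⟩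
    exact absurd h2 (not_lt.mpr (h t ht h1))

/-- HIDDEN-MISS BOUND: if consecutive grid points `a < b` bracket the truth edge (`a ≤ Tc + τ < b`, both in T22) and
the miss is invisible, then `lo ≤ b` — the band's lower edge cannot hide beyond the next grid point, so the hidden
miss `lo − (Tc + τ)` is at most the local grid gap `b − a`. [folklore] -/
theorem hidden_miss_le_gap {a b : ℚ} (hb : b ∈ T22) (hab : a ≤ Tc + τ) (hlt : Tc + τ < b)
    (hinv : visibleMissHigh Tc τ lo = false) : lo ≤ b ∧ lo - (Tc + τ) ≤ b - a := by
  have hlo : lo ≤ b := (missHigh_invisible_iff.mp hinv) b hb hlt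
  exact ⟨hlo, by linarith⟩

end visibility

/-! ## §2 The grid gaps (what a band can hide, per decade) -/

section gaps

/-- The successive gaps of T22: 0.1, 0.2, 0.7, 1, 2, 2, 4, 5, 5, 10, 10, 10, 20, 30, 30, 30, 40, 50, 50, 50, 50 K — the
largest miss-high a band can hide at a truth edge inside each interval (`hidden_miss_le_gap`). [folklore] -/
example : (T22.zip T22.tail).map (fun p => p.2 - p.1) =
    [1/10, 1/5, 7/10, 1, 2, 2, 4, 5, 5, 10, 10, 10, 20, 30, 30, 30, 40, 50, 50, 50, 50] := by norm_num [T22]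

/-- the grid is strictly increasing (each gap positive). [folklore] -/
example : ((T22.zip T22.tail).map (fun p => p.2 - p.1)).all (fun g => decide (0 < g)) = true := by norm_num [T22]

end gaps

/-! ## §3 Numbers of record -/

section cases

/-- RUN #3, M03 Nb (truth 9.25 K, err ≤ 1 ⇒ τ = 1 K; hubbard-eph band [12.575, 19.957] K): the 3.32 K miss is
INVISIBLE — no T22 point in (10.25, 12.575) — consistent with the 20/20 agreeing cells of record. [folklore] -/
example : tau (37 / 4) 1 = 1 ∧ visibleMissHigh (37 / 4) 1 (12575 / 1000) = false := by norm_num [tau, visibleMissHigh, T22]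

/-- … the next grid point above 10.25 K is 15 K: the band's lower edge could have hidden anywhere up to 15 K
(`hidden_miss_le_gap` with a = 10, b = 15: hidden miss < 5 K); a band starting at 16 K is VISIBLE at T = 15 K. [folklore] -/
example : visibleMissHigh (37 / 4) 1 15 = false ∧ visibleMissHigh (37 / 4) 1 16 = true := by norm_num [visibleMissHigh, T22]

/-- … and at that cell the W3-consistent word «SC» (T = 15 < lo = 16) DISAGREES with truth «not» (15 > 9.25 + 1). [folklore] -/
example : w3Cell 16 20 15 .SC = true ∧ outcome .SC (truthSC (37 / 4) 1 15) = .disagree := by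
  norm_num [w3Cell, outcome, truthSC, Word.not_ne_SC.symm]

/-- MgB₂ shape of `PhaseMapCellScore` §4 (39 K, τ = 1.95): the miss-high band [45, 60] is invisible (no grid point in
(40.95, 45)); [52, 60] is visible at T = 50 K. [folklore] -/
example : visibleMissHigh 39 (39 / 20) 45 = false ∧ visibleMissHigh 39 (39 / 20) 52 = true := by norm_num [visibleMissHigh, T22]

/-- H₃S shape (150 GPa column: 203 ± 8 K ⇒ τ = 10.15): a band starting at 240 K hides (next grid point 250); one
starting at 260 K is visible at 250 K — above 200 K a band can hide up to 50 K of miss. [folklore] -/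
example : tau 203 8 = 203 / 20 ∧ visibleMissHigh 203 (203 / 20) 240 = false ∧ visibleMissHigh 203 (203 / 20) 260 = true := by
  norm_num [tau, visibleMissHigh, T22]

end cases

end CellScore

end Summit.Ventures.CertifiedManyBodySolver.Downfold
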